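import Summits.CriticalPhenomena.PercolationContinuityZ3.Theorems.PercNearOneGluingNoHeavyPcintUFibDominating
import Summits.CriticalPhenomena.PercolationContinuityZ3.Theorems.PercNearOneGluingNoHeavyPcintUFibBridgeF
import Summits.CriticalPhenomena.PercolationContinuityZ3.Theorems.PercNearOneGluingNoHeavyPcintTFibBridgeT
import Literature.Probability.Percolation.SiteSharpnessDecay
import Literature.Probability.Percolation.TriSharpness
import HarnessLib

/-!
# PCINT lane, T-fibre route PHASE 2 assembled: `p_c^site(𝕋 × F) ≤ p` from the tail table of a usable-set rule

Cell `prim-pcint`, seat `prim-pcint-1` (gen 12); memo `run/shared/lean/prim/pcint/T-FIBRE-ROUTE.md` (PHASE 2).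

The generic-fibre version of the assembly of `…PcintTFibAssembly.lean`.  Site percolation on the triangular lattice `𝕋`
at `s > 1/2 = p_c^site(𝕋)` percolates (`triTheta_pos_of_half_lt`, Kesten 1982).  Its cluster exploration is dominated
step-wise by the usable-set fibre process on `𝕋 × F` at density `p` (`UFib.dominating`, from the tail table of the rule
`υ`), so by the coupling-free domination theorem `AdaptDom.expect_le_of_dominating`, the soundness of the process
(`UFib.exists_pathIn_of_reach`: needs `υ` to return open cells joined in the fibre to an open cell of the parent set, and
`F` connected from the root cell `i₀`) and the two bridges,

  `P_s^𝕋(0 ⟷ ∂ⁱⁿ box n) ≤ p^{-#Φ} · P_p^{𝕋 × F}((0,i₀) ⟷ ∂ⁱⁿ (box n × Φ))`   (`UFib.exit_le`),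

hence `θ^site_𝕋(s) ≤ p^{-#Φ} θ^site_{𝕋 × F}((0,i₀), p)` and **`UFib.siteCriticalProb_lfib_le` : `p_c^site(𝕋 × F) ≤ p`**.
The hypotheses are bundled in `UFib.RuleData` (the rule, its soundness, the root cell) and stated as the two numeric
conditions `hroot`, `htable` of `UFib.dominating`.
-/

noncomputable section

namespace Summit.CriticalPhenomena.PercolationContinuityZ3.Theorems.Pcint

namespace UFib

open Finset Filter Topology MeasureTheory AdaptDom ClusterExpl TFib
  Literature.Probability.Percolation Literature.Probability.LatticeModels

variable {Φ : Type*} [Fintype Φ] [DecidableEq Φ] (FA : SimpleGraph Φ) [DecidableRel FA.Adj]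

/-- `𝕋 × F` is locally finite. -/
instance instLocallyFiniteLfib : (lfib FA).LocallyFinite := fun x => SimpleGraph.boxProdFintypeNeighborSet x

/-- **Sound usable-set rules** (hypothesis structure of this file): a rule `υ` returning only open cells, each joined inside
the fibre (through open cells) to an open cell of the parent set, and a root cell `i₀` from which `F` is connected. -/
structure RuleData where
  /-- the usable-set rule -/
  υ : (Φ → Bool) → Finset Φ → Finset Φ
  /-- the root cell -/
  i₀ : Φ
  /-- usable cells are open -/
  open_of_mem : ∀ (y : Φ → Bool) (H : Finset Φ) (j : Φ), j ∈ υ y H → y j = true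
  /-- usable cells are joined in the fibre to an open cell of the parent set -/
  joined : ∀ (y : Φ → Bool) (H : Finset Φ) (j : Φ), j ∈ υ y H →
    ∃ i ∈ H, y i = true ∧ Relation.ReflTransGen (fun a b => FA.Adj a b ∧ y b = true) i j
  /-- `F` is connected from the root cell -/
  conn : ∀ j, Relation.ReflTransGen FA.Adj i₀ j

variable {FA} (D : RuleData FA)

/-! ### The box inequality -/

section Generic

variable {Λ : Finset (Site 2)} (pU sU : unitInterval)

omit [DecidableRel FA.Adj] in
open Classical in
/-- **The comparison inequality on a box**: under step-wise domination, the `π_s`-probability that `o` is joined to `B` by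
open sites of `Λ` (in `𝕋`) is at most the `muU`-weight of the fibre-state assignments with an open `𝕋 × F`-path of `cfgU w`
from `(o, i₀)` to the fibre of a site of `B`. -/
theorem sum_wt_reach_le_sum_muU_path (enc : ↥Λ → ℕ) (o : ↥Λ) (B : Finset ↥Λ) (hp : 0 < (pU : ℝ))
    (hdom : Dominating (sU : ℝ) (rule (boxGraphT Λ) enc o) (muU o (pU : ℝ)) (outU D.υ Λ enc o)) :
    ∑ ω : ↥Λ → Bool, wt (sU : ℝ) ω * reachIndicator (boxGraphT Λ) o B ω ≤
      ∑ w : ↥Λ → (Φ → Bool), muU o (pU : ℝ) w *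
        (if ∃ v ∈ B, ∃ j : Φ, PathIn (lfib FA) (cfgU Λ w) (o.1, D.i₀) (v.1, j) then (1 : ℝ) else 0) := by
  set N := Fintype.card ↥Λ + 1 with hN
  let ω₀ : ↥Λ → Bool := fun _ => false
  have h1 := expect_le_of_dominating sU.2.1 sU.2.2 (reachIndicator_mono (boxGraphT Λ) o B)
    (rule (boxGraphT Λ) enc o) (rule_unrevealed (boxGraphT Λ) enc o) (muU o (pU : ℝ)) (sum_muU hp) (outU D.υ Λ enc o)
    hdom N ω₀ (fun w ω => reach_determined (boxGraphT Λ) enc o B (outU D.υ Λ enc o w) ω ω₀)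
  refine h1.trans (Finset.sum_le_sum fun w _ => mul_le_mul_of_nonneg_left ?_ (muU_nonneg pU.2.1 pU.2.2 hp w))
  unfold reachIndicator
  split_ifs with hreach hpath
  · exact le_rfl
  · exfalso
    apply hpath
    have hval : reachIndicator (boxGraphT Λ) o B (merge (run (rule (boxGraphT Λ) enc o) (outU D.υ Λ enc o w) N) ω₀) = 1 := by
      unfold reachIndicator; rw [if_pos hreach]
    exact exists_pathIn_of_reach D.i₀ D.open_of_mem D.joined D.conn w B ω₀ hval
  · norm_num
  · norm_num

end Generic

/-! ### From the box inequality to exit probabilities and to `θ` -/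

omit [DecidableRel FA.Adj] in
/-- The fibre cells above `Λ` are `Λ × Φ`. -/
theorem coe_fibSites (Λ : Finset (Site 2)) :
    (↑(fibSites (Φ := Φ) Λ) : Set (Site 2 × Φ)) = ↑(Λ ×ˢ (univ : Finset Φ)) := by
  ext ⟨x, i⟩
  simp only [Finset.mem_coe, Finset.mem_product, Finset.mem_univ, and_true]
  constructor
  · intro h
    obtain ⟨v, j, hs⟩ := exists_eq_of_mem_fibSites Λ h
    simp only [Prod.mk.injEq] at hs
    rw [hs.1]; exact v.2
  · intro hx; exact mk_mem_fibSites Λ ⟨x, hx⟩ i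

/-- A path of the path event exits the product box: `fibPathEvent ⊆ exitEvent (𝕋 × F) (Λ × Φ) (0,i₀)` when `B` is the set
of inner-boundary sites and `o = 0`. -/
theorem fibPathEvent_subset_exitEvent {Λ : Finset (Site 2)} (h0 : (0 : Site 2) ∈ Λ) (i₀ : Φ) :
    fibPathEvent FA Λ ⟨0, h0⟩ i₀ (Λ.attach.filter fun v => v.1 ∈ innerBoundary triGraph Λ) ⊆
      exitEvent (lfib FA) (Λ ×ˢ (univ : Finset Φ)) ((0 : Site 2), i₀) := by
  classical
  rintro ω ⟨v, hv, j, hpath⟩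
  have hvb : v.1 ∈ innerBoundary triGraph Λ := (mem_filter.1 hv).2
  obtain ⟨-, y, hy, hadj⟩ := mem_innerBoundary_iff.1 hvb
  rw [mem_exitEvent_iff]
  refine ⟨(v.1, j), mem_innerBoundary_iff.2 ⟨mem_product.2 ⟨v.2, mem_univ _⟩, (y, j), ?_, ?_⟩, ?_⟩
  · rw [mem_product]; exact fun h => hy h.1
  · exact (lfib_adj FA).2 (Or.inl ⟨hadj, rfl⟩)
  · refine PathIn.mem_siteConnIn (hpath.mono fun s hs => ⟨?_, hs.1⟩)
    have := hs.2
    rw [coe_fibSites] at this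
    exact this

section Exit

variable (pU sU : unitInterval) (hp : 0 < (pU : ℝ))
  (hdom : ∀ (Λ : Finset (Site 2)) (enc : ↥Λ → ℕ) (o : ↥Λ),
    Dominating (sU : ℝ) (rule (boxGraphT Λ) enc o) (muU (Φ := Φ) o (pU : ℝ)) (outU D.υ Λ enc o))
include hp hdom

/-- **The box inequality in terms of exit probabilities**:
`P_s^𝕋(0 ⟷ ∂ⁱⁿ box n) ≤ p^{-#Φ} · P_p^{𝕋 × F}((0,i₀) ⟷ ∂ⁱⁿ (box n × Φ))`. -/
theorem exit_le (n : ℕ) :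
    (sitePercolation (Site 2) sU).real (exitEvent triGraph (box 2 n) 0) ≤
      (1 / wt (pU : ℝ) (uAll : Φ → Bool)) *
        (sitePercolation (Site 2 × Φ) pU).real
          (exitEvent (lfib FA) (box 2 n ×ˢ (univ : Finset Φ)) ((0 : Site 2), D.i₀)) := by
  classical
  set Λ := box 2 n with hΛ
  have h0 : (0 : Site 2) ∈ Λ := zero_mem_box 2 n
  set o : ↥Λ := ⟨0, h0⟩ with ho
  set B := Λ.attach.filter fun v => v.1 ∈ innerBoundary triGraph Λ with hB
  let enc : ↥Λ → ℕ := fun _ => 0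
  have hC : 0 < 1 / wt (pU : ℝ) (uAll : Φ → Bool) := div_pos one_pos (wt_uAll_pos hp)
  have ha := real_exitEvent_le_sum_wt_reach h0 sU
  have hb := sum_wt_reach_le_sum_muU_path D pU sU enc o B hp (hdom Λ enc o)
  have hcd : ∑ w : ↥Λ → (Φ → Bool), muU o (pU : ℝ) w *
        (if ∃ v ∈ B, ∃ j : Φ, PathIn (lfib FA) (cfgU Λ w) (o.1, D.i₀) (v.1, j) then (1 : ℝ) else 0) ≤
      (1 / wt (pU : ℝ) (uAll : Φ → Bool)) * (sitePercolation (Site 2 × Φ) pU).real (fibPathEvent FA Λ o D.i₀ B) := by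
    have hd := sum_pw_path_le_real_pathEvent (FA := FA) (Λ := Λ) pU o D.i₀ B
    calc _ ≤ ∑ w : ↥Λ → (Φ → Bool), pw (fun _ => wt (pU : ℝ)) w / wt (pU : ℝ) (uAll : Φ → Bool) *
          (if ∃ v ∈ B, ∃ j : Φ, PathIn (lfib FA) (cfgU Λ w) (o.1, D.i₀) (v.1, j) then (1 : ℝ) else 0) :=
          Finset.sum_le_sum fun w _ => mul_le_mul_of_nonneg_right (muU_le_pw pU.2.1 pU.2.2 hp w)
            (by split_ifs <;> norm_num)
      _ = (1 / wt (pU : ℝ) (uAll : Φ → Bool)) * ∑ w : ↥Λ → (Φ → Bool), pw (fun _ => wt (pU : ℝ)) w *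
          (if ∃ v ∈ B, ∃ j : Φ, PathIn (lfib FA) (cfgU Λ w) (o.1, D.i₀) (v.1, j) then (1 : ℝ) else 0) := by
          rw [Finset.mul_sum]
          exact Finset.sum_congr rfl fun w _ => by ring
      _ ≤ _ := mul_le_mul_of_nonneg_left hd hC.le
  have he : (sitePercolation (Site 2 × Φ) pU).real (fibPathEvent FA Λ o D.i₀ B) ≤
      (sitePercolation (Site 2 × Φ) pU).real
        (exitEvent (lfib FA) (Λ ×ˢ (univ : Finset Φ)) ((0 : Site 2), D.i₀)) :=
    measureReal_mono (fibPathEvent_subset_exitEvent h0 D.i₀) (measure_ne_top _ _)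
  calc (sitePercolation (Site 2) sU).real (exitEvent triGraph Λ 0)
      ≤ ∑ ω : ↥Λ → Bool, wt (sU : ℝ) ω * reachIndicator (boxGraphT Λ) o B ω := ha
    _ ≤ _ := hb
    _ ≤ (1 / wt (pU : ℝ) (uAll : Φ → Bool)) * (sitePercolation (Site 2 × Φ) pU).real (fibPathEvent FA Λ o D.i₀ B) := hcd
    _ ≤ _ := mul_le_mul_of_nonneg_left he hC.le

/-- **`θ^site_𝕋(s) ≤ p^{-#Φ} · θ^site_{𝕋 × F}((0,i₀), p)`.** -/
theorem siteTheta_tri_le :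
    siteTheta triGraph (0 : Site 2) sU ≤
      (1 / wt (pU : ℝ) (uAll : Φ → Bool)) * siteTheta (lfib FA) ((0 : Site 2), D.i₀) pU := by
  have hup : ∀ k : ℕ, siteTheta triGraph (0 : Site 2) sU ≤ (1 / wt (pU : ℝ) (uAll : Φ → Bool)) *
      (sitePercolation (Site 2 × Φ) pU).real
        (exitEvent (lfib FA) (box 2 k ×ˢ (univ : Finset Φ)) ((0 : Site 2), D.i₀)) := by
    intro k
    have h1 : siteTheta triGraph (0 : Site 2) sU ≤ (sitePercolation (Site 2) sU).real (exitEvent triGraph (box 2 k) 0) :=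
      measureReal_mono (sitePercolatesAt_subset_exitEvent (zero_mem_box 2 k)) (measure_ne_top _ _)
    exact h1.trans (exit_le D pU sU hp hdom k)
  have hmono : Monotone (fun k : ℕ => box 2 k ×ˢ (univ : Finset Φ)) :=
    fun a b hab => product_subset_product_left (box_mono 2 hab)
  have hex : ∀ v : Site 2 × Φ, ∃ k, v ∈ box 2 k ×ˢ (univ : Finset Φ) := fun v => by
    obtain ⟨k, hk⟩ := exists_mem_box v.1
    exact ⟨k, mem_product.2 ⟨hk, mem_univ _⟩⟩
  have h00 : ((0 : Site 2), D.i₀) ∈ box 2 0 ×ˢ (univ : Finset Φ) :=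
    mem_product.2 ⟨zero_mem_box 2 0, mem_univ _⟩
  have hlim := tendsto_siteTheta (G := lfib FA) hmono hex h00 pU
  have heq : ∀ k : ℕ, (⋂ i ≤ k, exitEvent (lfib FA) (box 2 i ×ˢ (univ : Finset Φ)) ((0 : Site 2), D.i₀)) =
      exitEvent (lfib FA) (box 2 k ×ˢ (univ : Finset Φ)) ((0 : Site 2), D.i₀) := by
    intro k
    apply Set.Subset.antisymm
    · intro ω hω; exact (Set.mem_iInter₂.1 hω) k le_rfl
    · exact Set.subset_iInter₂ fun i hi => exitEvent_anti (hmono hi) (mem_product.2 ⟨zero_mem_box 2 i, mem_univ _⟩)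
  simp_rw [heq] at hlim
  exact ge_of_tendsto' (hlim.const_mul _) hup

/-- **`p_c^site(𝕋 × F) ≤ p`** whenever `s > 1/2` (so that `θ_𝕋(s) > 0`). -/
theorem siteCriticalProb_lfib_le (hs : (1 / 2 : ℝ) < sU) :
    siteCriticalProb (lfib FA) ((0 : Site 2), D.i₀) ≤ pU := by
  have hθT : 0 < siteTheta triGraph (0 : Site 2) sU := triTheta_pos_of_half_lt sU hs
  have hC : 0 < 1 / wt (pU : ℝ) (uAll : Φ → Bool) := div_pos one_pos (wt_uAll_pos hp)
  have hpos : 0 < siteTheta (lfib FA) ((0 : Site 2), D.i₀) pU := by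
    have h := siteTheta_tri_le D pU sU hp hdom
    by_contra hle
    have h0 : siteTheta (lfib FA) ((0 : Site 2), D.i₀) pU = 0 :=
      le_antisymm (not_lt.1 hle) (by unfold siteTheta; exact measureReal_nonneg)
    rw [h0, mul_zero] at h
    exact absurd h (not_le.2 hθT)
  exact siteCriticalProb_le_of_siteTheta_pos (lfib FA) _ hpos

end Exit

/-! ### The criterion with the tail table -/

/-- **The PHASE-2 criterion**: for a sound usable-set rule with root cell `i₀`, numbers `0 < p ≤ 1`, `1/2 < s ≤ 1` with
`s ≤ 1 - (1-p)^{#Φ}` and the tail table of `UFib.dominating`, `p_c^site(𝕋 × F)((0, i₀)) ≤ p`. -/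
theorem siteCriticalProb_lfib_le_of_table (p s : ℝ) (hp0 : 0 < p) (hp1 : p ≤ 1) (hs : 1 / 2 < s) (hs1 : s ≤ 1)
    (hroot : s ≤ 1 - (1 - p) ^ Fintype.card Φ)
    (htable : ∀ (H : Finset Φ) (k : ℕ), k ≤ 5 → ∀ j, 1 ≤ j → j ≤ k →
      (∑ x : Φ → Bool, wt p x * (if meetsU x H = true then (1 : ℝ) else 0)) * binTail k s j ≤
        ∑ x : Φ → Bool, wt p x * (if meetsU x H = true then (1 : ℝ) else 0) * binTail k (1 - (1 - p) ^ (D.υ x H).card) j) :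
    siteCriticalProb (lfib FA) ((0 : Site 2), D.i₀) ≤ p := by
  have hs0 : 0 ≤ s := by linarith
  have h := siteCriticalProb_lfib_le D ⟨p, hp0.le, hp1⟩ ⟨s, hs0, hs1⟩ hp0
    (fun Λ enc o => dominating D.υ enc (o := o) (p := p) hp0 hp1 hs0 hs1 hroot htable) hs
  simpa using h

end UFib

end Summit.CriticalPhenomena.PercolationContinuityZ3.Theorems.Pcint

end
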